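import Mathlib
import HarnessLib

/-!
# Tame automorphisms of a local ring are detected on the cotangent space

Let `A` be a Noetherian local ring and `φ` a ring automorphism of `A` of finite order `m`, with
`m` invertible in `A` ("tame"). If `φ` induces the identity on the residue field `A/𝔪` and on the
cotangent space `𝔪/𝔪²`, then `φ` is the identity. This is the algebraic form of the classical
rigidity "a finite group of order prime to the residue characteristic acting on a (complete)
local ring acts faithfully on the tangent space" (Serre, *Corps locaux* IV §2, proof of Prop. 7
for discrete valuation rings; Cartan's linearisation lemma for complete local rings over a field),
used constantly in the local study of group actions on regular schemes — e.g. in the analysis of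
inertia strata for the resolution of wild quotient singularities, where it shows that the
p-closed residual of a non-p-closed inertia group (which always contains an element of order
prime to `p`) has a fixed locus of codimension `≥ 2`.

Proof (no completeness needed, only Krull's intersection theorem): `φ` is the identity on the
associated graded ring (`apply_sub_self_mem_maximalIdeal_pow_succ`: `φ a - a ∈ 𝔪ⁿ⁺¹` for `a ∈ 𝔪ⁿ`,
by induction from degrees `0` and `1`), and the Reynolds operator `e(a) = m⁻¹ ∑_{j<m} φʲ(a)`
produces `φ`-invariants with `a - e(a) ∈ 𝔪ⁿ` as soon as `φ ≡ 1 (mod 𝔪ⁿ)`; then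
`φ a - a = φ(a - e a) - (a - e a) ∈ 𝔪ⁿ⁺¹`, so `φ a - a ∈ ⋂ₙ 𝔪ⁿ = 0`.

* `map_maximalIdeal_pow_le` — automorphisms of a local ring preserve `𝔪ⁿ`.
* `apply_sub_self_mem_maximalIdeal_pow_succ` — identity on `gr A` from identity on `gr⁰ ⊕ gr¹`.
* `ringEquiv_eq_one_of_cotangentTrivial_of_isUnit_orderOf` — the theorem.
-/

namespace Literature.RingTheory.CompleteLocalRings

open IsLocalRing

variable {A : Type*} [CommRing A] [IsLocalRing A]

/-- A ring automorphism of a local ring maps every power of the maximal ideal into itself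
(ideal form: `φ(𝔪ⁿ) ⊆ 𝔪ⁿ`; for discrete valuation rings cf.
`Literature.AlgebraicGeometry.Ramification.ringEquiv_apply_mem_maximalIdeal_pow`). [folklore] -/
theorem map_maximalIdeal_pow_le (φ : A ≃+* A) (n : ℕ) :
    Ideal.map (φ : A →+* A) (maximalIdeal A ^ n) ≤ maximalIdeal A ^ n := by
  have hle : Ideal.map (φ : A →+* A) (maximalIdeal A) ≤ maximalIdeal A := by
    rw [Ideal.map_le_iff_le_comap]
    intro x hx
    rw [Ideal.mem_comap, mem_maximalIdeal, mem_nonunits_iff]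
    rw [mem_maximalIdeal, mem_nonunits_iff] at hx
    intro hu
    exact hx (by simpa using hu.map φ.symm)
  rw [Ideal.map_pow]
  exact Ideal.pow_right_mono hle n

/-- **Identity on `gr A` from identity on `gr⁰ ⊕ gr¹`.** If the automorphism `φ` of the local ring
`A` induces the identity on `A/𝔪` (`φ a - a ∈ 𝔪`) and on `𝔪/𝔪²` (`φ a - a ∈ 𝔪²` for `a ∈ 𝔪`), then
`φ a - a ∈ 𝔪ⁿ⁺¹` for all `a ∈ 𝔪ⁿ`: write a generator of `𝔪ⁿ⁺¹ = 𝔪ⁿ·𝔪` as `x y` and use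
`φ(xy) - xy = φ(x)(φ y - y) + (φ x - x) y`. [folklore] -/
theorem apply_sub_self_mem_maximalIdeal_pow_succ (φ : A ≃+* A)
    (hres : ∀ a : A, φ a - a ∈ maximalIdeal A)
    (hcot : ∀ a ∈ maximalIdeal A, φ a - a ∈ maximalIdeal A ^ 2) :
    ∀ (n : ℕ) {a : A}, a ∈ maximalIdeal A ^ n → φ a - a ∈ maximalIdeal A ^ (n + 1) := by
  intro n
  induction n with
  | zero => intro a _; simpa using hres a
  | succ n ih =>
    intro a ha
    rw [pow_succ] at ha
    refine Submodule.mul_induction_on ha (fun x hx y hy => ?_) (fun x y hx hy => ?_)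
    · have e : φ (x * y) - x * y = φ x * (φ y - y) + (φ x - x) * y := by rw [map_mul]; ring
      rw [e, show n + 1 + 1 = n + 2 from rfl]
      refine Ideal.add_mem _ ?_ ?_
      · have := Ideal.mul_mem_mul (map_maximalIdeal_pow_le φ n (Ideal.mem_map_of_mem _ hx))
          (hcot y hy)
        rwa [← pow_add] at this
      · have := Ideal.mul_mem_mul (ih hx) hy
        rwa [← pow_succ] at this
    · have e : φ (x + y) - (x + y) = (φ x - x) + (φ y - y) := by rw [map_add]; ring
      rw [e]
      exact Ideal.add_mem _ hx hy

/-- **Tame automorphisms are detected on the cotangent space.** Let `A` be a Noetherian local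
ring and `φ : A ≃+* A` an automorphism whose (finite) order `m` is a unit of `A`. If `φ` is the
identity on the residue field and on the cotangent space `𝔪/𝔪²`, then `φ = 1`. (Reynolds
operator + `apply_sub_self_mem_maximalIdeal_pow_succ` + Krull's intersection theorem; no
completeness assumption.) [cite: Serre1979, Ch. IV §2, proof of Prop. 7] -/
theorem ringEquiv_eq_one_of_cotangentTrivial_of_isUnit_orderOf [IsNoetherianRing A]
    (φ : A ≃+* A) (hres : ∀ a : A, φ a - a ∈ maximalIdeal A)
    (hcot : ∀ a ∈ maximalIdeal A, φ a - a ∈ maximalIdeal A ^ 2)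
    (hm : IsUnit ((orderOf φ : ℕ) : A)) (_hord : 0 < orderOf φ) : φ = 1 := by
  set m := orderOf φ with hmdef
  obtain ⟨mi, hmi⟩ := hm.exists_left_inv
  have hgr := apply_sub_self_mem_maximalIdeal_pow_succ φ hres hcot
  -- the Reynolds operator
  let e : A → A := fun a => mi * (Finset.range m).sum fun j => (φ ^ j) a
  have he_inv : ∀ a, φ (e a) = e a := by
    intro a
    simp only [e, map_mul, map_sum]
    have hmi' : φ mi = mi := by
      have h1 : φ mi * (m : A) = 1 := by
        have := congrArg φ hmi
        rwa [map_mul, map_natCast, map_one] at this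
      calc φ mi = φ mi * ((m : A) * mi) := by rw [mul_comm (m : A) mi, hmi, mul_one]
        _ = (φ mi * (m : A)) * mi := by ring
        _ = mi := by rw [h1, one_mul]
    rw [hmi']
    congr 1
    have hshift : ∀ j, φ ((φ ^ j) a) = (φ ^ (j + 1)) a := fun j => by
      rw [pow_succ', RingAut.mul_apply]
    simp_rw [hshift]
    have hperiod : (φ ^ m) a = (φ ^ 0) a := by rw [pow_orderOf_eq_one, pow_zero]
    have := Finset.sum_range_succ_comm (fun j => (φ ^ j) a) m
    rw [Finset.sum_range_succ'] at this
    rw [hperiod, add_comm ((φ ^ 0) a)] at this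
    exact add_right_cancel this
  have he_sub : ∀ n : ℕ, (∀ a, φ a - a ∈ maximalIdeal A ^ n) →
      ∀ a, a - e a ∈ maximalIdeal A ^ n := by
    intro n hn a
    have hpow : ∀ j : ℕ, (φ ^ j) a - a ∈ maximalIdeal A ^ n := by
      intro j
      induction j with
      | zero => simp
      | succ j ih =>
        have : (φ ^ (j + 1)) a - a = (φ ((φ ^ j) a) - (φ ^ j) a) + ((φ ^ j) a - a) := by
          rw [pow_succ', RingAut.mul_apply]; ring
        rw [this]
        exact Ideal.add_mem _ (hn _) ih
    have hrepr : a - e a = mi * (Finset.range m).sum (fun j => a - (φ ^ j) a) := by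
      simp only [e, Finset.sum_sub_distrib, Finset.sum_const, Finset.card_range, nsmul_eq_mul,
        mul_sub]
      rw [← mul_assoc, hmi, one_mul]
    rw [hrepr]
    refine Ideal.mul_mem_left _ _ (Ideal.sum_mem _ fun j _ => ?_)
    rw [← neg_sub]
    exact Submodule.neg_mem _ (hpow j)
  -- induction on the level
  have hlevel : ∀ n : ℕ, ∀ a, φ a - a ∈ maximalIdeal A ^ n := by
    intro n
    induction n with
    | zero => intro a; simp
    | succ n ih =>
      intro a
      have hc : a - e a ∈ maximalIdeal A ^ n := he_sub n ih a
      have hdecomp : φ a - a = φ (a - e a) - (a - e a) := by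
        rw [map_sub, he_inv]; ring
      rw [hdecomp]
      exact hgr n hc
  -- Krull intersection
  apply RingEquiv.ext
  intro a
  have hmem : φ a - a ∈ (⨅ n : ℕ, maximalIdeal A ^ n) := Ideal.mem_iInf.mpr fun n => hlevel n a
  rw [Ideal.iInf_pow_eq_bot_of_isLocalRing _ (maximalIdeal.isMaximal A).ne_top,
    Ideal.mem_bot, sub_eq_zero] at hmem
  simpa using hmem

/-- **A tame automorphism which is the identity on the cotangent space and the residue field is
trivial** — group-action form: for a finite group `G` acting faithfully on a Noetherian local
ring `A` in which `|G|` is invertible (e.g. `A` an `𝔽_p`-algebra and `p ∤ |G|`), trivially on the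
residue field, every `g` acting trivially on `𝔪/𝔪²` is `1`. In other words such a `G` acts
faithfully on `gr⁰ ⊕ gr¹`, i.e. (for trivial residue action) on the cotangent space. [folklore] -/
theorem eq_one_of_cotangentTrivial [IsNoetherianRing A] {G : Type*} [Group G] [Finite G]
    (σ : G →* (A ≃+* A)) (hσ : Function.Injective σ) (hcard : IsUnit ((Nat.card G : ℕ) : A))
    (hres : ∀ (g : G) (a : A), σ g a - a ∈ maximalIdeal A) (g : G)
    (hcot : ∀ a ∈ maximalIdeal A, σ g a - a ∈ maximalIdeal A ^ 2) : g = 1 := by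
  have hdvd : orderOf (σ g) ∣ Nat.card G := (orderOf_map_dvd σ g).trans (orderOf_dvd_natCard g)
  have hunit : IsUnit ((orderOf (σ g) : ℕ) : A) := by
    obtain ⟨c, hc⟩ := hdvd
    have h : ((Nat.card G : ℕ) : A) = (orderOf (σ g) : A) * (c : A) := by rw [hc, Nat.cast_mul]
    rw [h] at hcard
    exact isUnit_of_mul_isUnit_left hcard
  have hord : 0 < orderOf (σ g) := (σ.isOfFinOrder (isOfFinOrder_of_finite g)).orderOf_pos
  have h1 : σ g = 1 :=
    ringEquiv_eq_one_of_cotangentTrivial_of_isUnit_orderOf (σ g) (hres g) hcot hunit hord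
  exact hσ (by rw [h1, map_one])

end Literature.RingTheory.CompleteLocalRings
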